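import Literature.Computability.Complexity.ProbabilisticClasses
import HarnessLib

/-!
# Complexity core: interactive proofs with a probabilistic verifier (`IP[k]`, `IP`)

Arora–Barak's Definition 8.6 over the tree's Turing-machine classes `P`/`FP`
(`Classes.lean`): a *private-coin* interactive proof is an interaction between a probabilistic
polynomial-time verifier, which on input `x` draws its random tape `r ∈ {0,1}^{c(|x|)}` once and
computes its messages `a₁ = f(x, r)`, `a₃ = f(x, r, a₁, a₂)`, … and finally a verdict, and a
prover, an arbitrary function `a₂ = g(x, a₁)`, `a₄ = g(x, a₁, a₂, a₃)`, … of the messages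
exchanged so far which does **not** see `r` (AB Def. 8.6 and the paragraph before it, printed
p. 146 = PDF p. 178 of the held copy). `L ∈ IP[k]` iff some such verifier has, for every `x`,
completeness `x ∈ L ⇒ ∃ P, Pr_r[accept] ≥ 2/3` and soundness `x ∉ L ⇒ ∀ P, Pr_r[accept] ≤ 1/3`
with `k(|x|)` messages exchanged, the verifier speaking first; `IP = ⋃_{c ≥ 1} IP[n^c]`.

Contents:

* `IPProver` — a prover strategy for one input: messages so far ↦ reply (deterministic and
  computationally unbounded; AB §8.1, Remark after Lemma 8.7, item 1: a probabilistic prover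
  can be replaced by a deterministic one by averaging);
* `IPVerifier` — coin and message-length polynomials, a next-message function `next` and a
  verdict language `verdict`, both applied to the verifier's view
  `⟨x, ⟨r, enc (a₁, …, aᵢ)⟩⟩` (`IPVerifier.view`); `IsPolyTime` = `next ∈ FP ∧ verdict ∈ P`;
  `transcript`, `Accepts`, `acceptProb` (a `uniformProb` over the coins), `Proves k L`
  (AB's completeness/soundness clauses (8.2), (8.3));
* the classes `IPRounds k` (`k : ℕ → ℕ` messages on inputs of length `n`), `IPk k` (constant
  `k`) and `IP`;
* API: `length_transcript` (exactly `k` messages are exchanged), `transcript_one` /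
  `acceptProb_one` (with one message the prover has no influence, the case `IP[1] = BPP`),
  `acceptProb_nonneg`, `acceptProb_le_one`, `mem_IPRounds_iff`, `IPRounds_pow_subset_IP`;
* the named fact `IPk_subset_AM` — constant-round `IP` is `AM` (Goldwasser–Sipser 1986 with
  Babai–Moran 1988), in the tree's `AM = bp NP`; its decomposition into single-source facts and
  its proof from them are in `ArthurMerlinGames.lean`.

Mathlib has no interactive proofs, Arthur–Merlin games or `IP` (searched `Interactive`,
`ArthurMerlin`, `Verifier`, `IP`, `AM`: nothing relevant; `Literature.Analysis.ValidatedNumerics`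
has an unrelated `Verifier` structure for certificate checking, hence the prefix `IP`). We reuse
`boolPair`, `Computability.Encoding.listBool`, `uniformProb`, `P`, `FP`, and Mathlib's `List.takeD`
(with `List.takeD_length`, `List.takeD_eq_take`) for the message-length normalisation.
Public-coin (Arthur–Merlin) games, the classes `AM[k]`/`MA[k]`, and the named facts relating
them to `IP[k]` (Goldwasser–Sipser, Babai–Moran) are in `ArthurMerlinGames.lean`.

## Design notes (what is, and is not, literally Arora–Barak's wording)

* The verifier is presented *extensionally*: instead of one probabilistic Turing machine we take
  its next-message function `next ∈ FP` and its final decision `verdict ∈ P`, both as functions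
  of the whole view `⟨x, ⟨r, enc transcript⟩⟩`. A `T(n)`-time interactive machine yields such a
  pair (replay the interaction from the view), and conversely `k(|x|)` evaluations of `next` plus
  one of `verdict` on views of polynomial length take polynomial time when `k(n) ≤ poly(n)`. The
  model is therefore adequate exactly for polynomially bounded round functions `k` that the
  verifier can compute (AB Thm. 8.12: "`k(n)` computable in `poly(n)`"); `IP` only uses
  `k(n) = n^c`, and `IPk` constants. For an arbitrary `k : ℕ → ℕ` the verdict could read the
  non-computable quantity `k(|x|)` off the transcript length — do not instantiate `IPRounds` with
  such `k`.
* All messages on input `x` — the prover's and the verifier's — are normalised by Mathlib's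
  `List.takeD m · false` (truncate / pad with `false`; no parallel API is introduced) to the
  common length `m = msgLen(|x|)`. For the prover this is the indispensable bound "the verifier
  only reads polynomially many bits of each answer" (without it `verdict ∈ P`, being polynomial
  in the length of its own input, would be handed exponential time by a padding prover); for the
  verifier it is without loss of generality (its messages are polynomially bounded anyway; pad).
  One polynomial for all message lengths is likewise a padding normal form.
* The prover strategy is chosen per input `x` (AB (8.2): "`x ∈ L ⇒ ∃ P`"), so `IPProver` need
  not take `x` as an argument; it sees the list of all messages so far (its own included) but
  never `r` (private coins).
* Thresholds `2/3`, `1/3` are AB's (8.2)–(8.3), as in the tree's `bp` operator.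

## References

* S. Arora, B. Barak, *Computational Complexity: A Modern Approach*, CUP 2009, §8.1.1–8.1.2:
  Def. 8.6 (probabilistic verifiers and the class `IP`, with the private-coins paragraph before
  it), Lemma 8.7 and the remarks after it (deterministic provers suffice), §8.2 Def. 8.10.
* S. Goldwasser, S. Micali, C. Rackoff, *The knowledge complexity of interactive proof systems*,
  SIAM J. Comput. 18 (1989) (interactive proofs; cited through Arora–Barak's chapter notes).
* L. Babai, S. Moran, *Arthur–Merlin games: a randomized proof system, and a hierarchy of
  complexity classes*, JCSS 36 (1988), §1.5 (`IP(t(n))`: "`t(n)` moves, verifier moves first";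
  `IP(t(n)) ⊆ AM(t(n)+2)` and the Collapse Theorem), Thm. 3.
* S. Goldwasser, M. Sipser, *Private coins versus public coins in interactive proof systems*,
  STOC 1986, 59–68 (held), §4.2 Main Theorem (`IP[Q(n)] ⊆ AM[Q(n)+2]`).
-/

namespace Literature.Computability.Complexity

open _root_.Computability

/-! ### Provers, verifiers and the interaction (Arora–Barak Def. 8.6) -/

/-- A **prover strategy** for one fixed input `x`: the list of messages exchanged so far
(`a₁, …, aᵢ`, verifier's and prover's alike, in order) ↦ the prover's next message. It is an
arbitrary function — computationally unbounded and, without loss of generality, deterministic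
— and it does not see the verifier's coins (private-coin model). (AB Def. 8.6: `P : {0,1}* →
{0,1}*` with `a₂ᵢ = P(x, a₁, …, a₂ᵢ₋₁)`; the dependence on `x` is absorbed by choosing the
strategy per input.) [cite: AroraBarakCC2009, Def. 8.6] -/
abbrev IPProver : Type := List (List Bool) → List Bool

/-- A **probabilistic polynomial-time verifier**, presented extensionally (module docstring):
on input `x` it uses `coins(|x|)` private random bits `r`, all messages have length
`msgLen(|x|)`, its `i`-th message is `next ⟨x, ⟨r, enc (a₁, …, a_{2i-2})⟩⟩` and at the end it
accepts iff `⟨x, ⟨r, enc (a₁, …, a_k)⟩⟩ ∈ verdict` (AB: `a₁ = f(x, r)`, `a₃ = f(x, r, a₁, a₂)`,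
…; polynomial time is the separate predicate `IsPolyTime`). [cite: AroraBarakCC2009, Def. 8.6] -/
structure IPVerifier where
  /-- Number of private coins on inputs of length `n` (a polynomial). -/
  coins : Polynomial ℕ
  /-- Common length of all messages on inputs of length `n` (a polynomial). -/
  msgLen : Polynomial ℕ
  /-- Next-message function, applied to the view `⟨x, ⟨r, enc transcript⟩⟩`. -/
  next : List Bool → List Bool
  /-- Final decision: accept iff the view `⟨x, ⟨r, enc transcript⟩⟩` lies in this language. -/
  verdict : Language Bool

namespace IPVerifier

/-- The verifier's **view** `⟨x, ⟨r, enc (a₁, …, aᵢ)⟩⟩`: input, private coins and the messages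
so far (the list encoded by `Computability.Encoding.listBool` over the identity string encoding).
(AB Def. 8.6: the arguments `(x, r, a₁, …, aᵢ)` of the verifier's function `f`.)
[cite: AroraBarakCC2009, Def. 8.6] -/
def view (x r : List Bool) (msgs : List (List Bool)) : List Bool :=
  boolPair x (boolPair r ((encodingList Bool).listBool.encode msgs))

/-- Fuel-indexed interaction: continue the transcript `t` for `k` more messages, the flag saying
whether the verifier (`true`) or the prover (`false`) speaks next; every message is normalised
to length exactly `m` by Mathlib's `List.takeD m · false` (truncate, or pad with `false`). (AB Def. 8.2/8.6: `a₁ = f(x,r)`, `a₂ = g(x,a₁)`, `a₃ = f(x,r,a₁,a₂)`,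
….) [cite: AroraBarakCC2009, Def. 8.6] -/
def transcriptAux (V : IPVerifier) (x r : List Bool) (P : IPProver) (m : ℕ) :
    Bool → ℕ → List (List Bool) → List (List Bool)
  | _, 0, t => t
  | true, k + 1, t => transcriptAux V x r P m false k (t ++ [(V.next (view x r t)).takeD m false])
  | false, k + 1, t => transcriptAux V x r P m true k (t ++ [(P t).takeD m false])

/-- **The transcript** `(a₁, …, a_k)` of the `k`-message interaction of `V` (speaking first,
coins `r`) with the prover strategy `P` on input `x`, messages of length `msgLen(|x|)`.
[cite: AroraBarakCC2009, Def. 8.6] -/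
def transcript (V : IPVerifier) (k : ℕ) (x r : List Bool) (P : IPProver) : List (List Bool) :=
  V.transcriptAux x r P (V.msgLen.eval x.length) true k []

/-- The verifier **accepts** the `k`-message interaction on input `x` with coins `r` against `P`
(`out_V⟨V, P⟩(x) = 1` for these coins). [cite: AroraBarakCC2009, Def. 8.6] -/
def Accepts (V : IPVerifier) (k : ℕ) (x r : List Bool) (P : IPProver) : Prop :=
  view x r (V.transcript k x r P) ∈ V.verdict

/-- **Acceptance probability** `Pr_r[out_V⟨V, P⟩(x) = 1]` over the private coins
`r ∈ {0,1}^{coins(|x|)}` (counting form, `uniformProb`). [cite: AroraBarakCC2009, Def. 8.6] -/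
noncomputable def acceptProb (V : IPVerifier) (k : ℕ) (x : List Bool) (P : IPProver) : ℝ :=
  uniformProb (V.coins.eval x.length) {r | V.Accepts k x r P}

/-- The verifier is **probabilistic polynomial-time**: its next-message function is in `FP` and
its verdict in `P` (as functions of the view, whose length is polynomial in `|x|` for
polynomially many rounds; module docstring). [cite: AroraBarakCC2009, Def. 8.6] -/
def IsPolyTime (V : IPVerifier) : Prop :=
  V.next ∈ FP ∧ V.verdict ∈ Classes.P

/-- **`V` proves membership in `L` within `k(|x|)` messages** (AB (8.2)–(8.3)):
completeness `x ∈ L ⇒ ∃ P, Pr[accept] ≥ 2/3` and soundness `x ∉ L ⇒ ∀ P, Pr[accept] ≤ 1/3`.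
[cite: AroraBarakCC2009, Def. 8.6] -/
def Proves (V : IPVerifier) (k : ℕ → ℕ) (L : Language Bool) : Prop :=
  ∀ x : List Bool,
    (x ∈ L → ∃ P : IPProver, (2 / 3 : ℝ) ≤ V.acceptProb (k x.length) x P) ∧
      (x ∉ L → ∀ P : IPProver, V.acceptProb (k x.length) x P ≤ 1 / 3)

end IPVerifier

/-! ### The classes `IP[k]` and `IP` -/

/-- **`IPRounds k = IP[k]`** for a round function `k : ℕ → ℕ`: languages having a probabilistic
polynomial-time verifier that proves membership within `k(|x|)` messages (verifier first) with
completeness `2/3` and soundness error `1/3` against all provers. Adequate for polynomially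
bounded, verifier-computable `k` (module docstring). [cite: AroraBarakCC2009, Def. 8.6] -/
def IPRounds (k : ℕ → ℕ) : Set (Language Bool) :=
  {L | ∃ V : IPVerifier, V.IsPolyTime ∧ V.Proves k L}

/-- **`IPk k = IP[k]` for a constant number `k` of messages** (e.g. `IP[2]`: the verifier sends a
message, the prover answers, the verifier decides). [cite: AroraBarakCC2009, Def. 8.6] -/
abbrev IPk (k : ℕ) : Set (Language Bool) :=
  IPRounds fun _ => k

/-- **`IP = ⋃_{c ≥ 1} IP[n^c]`**: interactive proofs with polynomially many rounds.
[cite: AroraBarakCC2009, Def. 8.6] -/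
def IP : Set (Language Bool) :=
  ⋃ (c : ℕ) (_ : 1 ≤ c), IPRounds fun n => n ^ c

/-! ### API -/

namespace IPVerifier

variable (V : IPVerifier)

/-- Continuing a transcript for `k` more messages appends exactly `k` messages. [folklore] -/
theorem length_transcriptAux (x r : List Bool) (P : IPProver) (m : ℕ) (b : Bool) (k : ℕ)
    (t : List (List Bool)) : (V.transcriptAux x r P m b k t).length = t.length + k := by
  induction k generalizing b t with
  | zero => cases b <;> simp [transcriptAux]
  | succ k ih =>
    cases b <;> simp only [transcriptAux, ih, List.length_append, List.length_cons,
      List.length_nil] <;> omega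

/-- **Exactly `k` messages are exchanged in a `k`-message interaction.**
[cite: AroraBarakCC2009, Def. 8.6] -/
@[simp] theorem length_transcript (k : ℕ) (x r : List Bool) (P : IPProver) :
    (V.transcript k x r P).length = k := by
  simp [transcript, length_transcriptAux]

/-- Every message of the continued transcript is one of the given ones or has the normalised
length `m`. [folklore] -/
theorem length_eq_of_mem_transcriptAux (x r : List Bool) (P : IPProver) (m : ℕ) (b : Bool)
    (k : ℕ) (t : List (List Bool)) (ht : ∀ s ∈ t, s.length = m) :
    ∀ s ∈ V.transcriptAux x r P m b k t, s.length = m := by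
  induction k generalizing b t with
  | zero => cases b <;> simpa [transcriptAux] using ht
  | succ k ih =>
    cases b
    · exact ih true _ fun s hs => by
        rcases List.mem_append.1 hs with h | h
        · exact ht s h
        · rw [List.mem_singleton.1 h, List.takeD_length]
    · exact ih false _ fun s hs => by
        rcases List.mem_append.1 hs with h | h
        · exact ht s h
        · rw [List.mem_singleton.1 h, List.takeD_length]

/-- **All messages have length `msgLen(|x|)`.** [cite: AroraBarakCC2009, Def. 8.6] -/
theorem length_eq_of_mem_transcript (k : ℕ) (x r : List Bool) (P : IPProver)
    {s : List Bool} (hs : s ∈ V.transcript k x r P) : s.length = V.msgLen.eval x.length :=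
  V.length_eq_of_mem_transcriptAux x r P _ true k [] (fun _ h => by simp at h) s hs

/-- With no message the transcript is empty. [folklore] -/
@[simp] theorem transcript_zero (x r : List Bool) (P : IPProver) : V.transcript 0 x r P = [] :=
  rfl

/-- **With a single message the prover has no influence**: the transcript is the verifier's
first message. (The case `k = 1`, in which `IP[1]` is just `BPP`; Babai–Moran: `AM(1) = BPP`.)
[cite: AroraBarakCC2009, Def. 8.6] -/
theorem transcript_one (x r : List Bool) (P : IPProver) :
    V.transcript 1 x r P = [(V.next (view x r [])).takeD (V.msgLen.eval x.length) false] :=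
  rfl

/-- Hence one-message acceptance probabilities do not depend on the prover. [folklore] -/
theorem acceptProb_one (x : List Bool) (P P' : IPProver) :
    V.acceptProb 1 x P = V.acceptProb 1 x P' := by
  simp only [acceptProb, Accepts, transcript_one]

/-- Likewise with no message at all (`IP[0] = BPP`). [folklore] -/
theorem acceptProb_zero (x : List Bool) (P P' : IPProver) :
    V.acceptProb 0 x P = V.acceptProb 0 x P' := by
  simp only [acceptProb, Accepts, transcript_zero]

/-- Acceptance probabilities are nonnegative. [folklore] -/
theorem acceptProb_nonneg (k : ℕ) (x : List Bool) (P : IPProver) : 0 ≤ V.acceptProb k x P :=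
  uniformProb_nonneg _ _

/-- Acceptance probabilities are at most `1`. [folklore] -/
theorem acceptProb_le_one (k : ℕ) (x : List Bool) (P : IPProver) : V.acceptProb k x P ≤ 1 :=
  uniformProb_le_one _ _

/-- A verifier that proves `L` is sound on `L`'s complement in the strong sense that NO prover
reaches `2/3` there (the two clauses of `Proves` never conflict). [cite: AroraBarakCC2009, Def. 8.6] -/
theorem Proves.not_le_of_not_mem {V : IPVerifier} {k : ℕ → ℕ} {L : Language Bool}
    (h : V.Proves k L) {x : List Bool} (hx : x ∉ L) (P : IPProver) :
    ¬ (2 / 3 : ℝ) ≤ V.acceptProb (k x.length) x P := by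
  have h' := (h x).2 hx P
  intro h2
  linarith

end IPVerifier

/-- Unfolding lemma for `IPRounds`. [cite: AroraBarakCC2009, Def. 8.6] -/
theorem mem_IPRounds_iff {k : ℕ → ℕ} {L : Language Bool} :
    L ∈ IPRounds k ↔ ∃ V : IPVerifier, V.IsPolyTime ∧ V.Proves k L :=
  Iff.rfl

/-- Unfolding lemma for `IP`. [cite: AroraBarakCC2009, Def. 8.6] -/
theorem mem_IP_iff {L : Language Bool} :
    L ∈ IP ↔ ∃ c : ℕ, 1 ≤ c ∧ L ∈ IPRounds fun n => n ^ c := by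
  simp only [IP, Set.mem_iUnion, exists_prop]

/-- `IP[n^c] ⊆ IP` for `c ≥ 1`. [cite: AroraBarakCC2009, Def. 8.6] -/
theorem IPRounds_pow_subset_IP {c : ℕ} (hc : 1 ≤ c) : IPRounds (fun n => n ^ c) ⊆ IP :=
  fun _ hL => mem_IP_iff.2 ⟨c, hc, hL⟩

/-- Membership in `IPRounds k` only depends on the values of `k` (extensionality in the round
function, for rewriting `fun _ => k` forms). [folklore] -/
theorem IPRounds_congr {k k' : ℕ → ℕ} (h : ∀ n, k n = k' n) : IPRounds k = IPRounds k' := by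
  rw [show k = k' from funext h]

/-! ### Named fact: constant-round interactive proofs are Arthur–Merlin -/

/-- **Constant-round interactive proofs are `AM`: `IP[k] ⊆ AM` for every constant `k`.**
Goldwasser–Sipser (STOC 1986): `IP(t(n)) ⊆ AM(t(n)+2)`, "which, combined with the Collapse
Theorem yields … `AM(t(n)) = IP(t(n))`" (Babai–Moran 1988, §1.5 with Thm. 3: for constant
`k ≥ 2`, `AM = AM(k)`), read in the tree's `AM = BP·NP = AM[2]` (Arora–Barak Remark 8.11(2));
Arora–Barak Thm. 8.12 with Remark 8.11(3). The public-coin classes `AM[k]`, the three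
single-source facts and the PROOF of this corollary from them
(`Literature.Computability.Complexity.IPk_subset_AM_of`) are in `ArthurMerlinGames.lean`; the
corollary is kept as a named fact here because it is the form consumed by "unless `coNP ⊆ AM`"
no-go theorems with constant-round protocols (e.g.
`Literature.Barriers.PneNP.NPHardnessToOneWayFunctions`). [cite: BabaiMoran1988, §1.5 and Thm. 3]
[cite: GoldwasserSipser1986, §4.2 Main Theorem] [cite: AroraBarakCC2009, Thm. 8.12 and Remark 8.11] -/
def IPk_subset_AM : Prop :=
  ∀ k : ℕ, IPk k ⊆ AM

end Literature.Computability.Complexity
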